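import Mathlib
import HarnessLib
import Summits.HubbardSuperconductivity.HubbardSuperconductivity.Theorems.KLProgrammeKLRegimeTwoVolumeTowerStepCovZeroPlainSymbol
import Summits.HubbardSuperconductivity.HubbardSuperconductivity.Theorems.KLProgrammeKLRegimeSliceSymbolTorusIncrement
import Summits.HubbardSuperconductivity.HubbardSuperconductivity.Theorems.KLProgrammeKLRegimeSliceSymbolTorusIncrementTime
import Summits.HubbardSuperconductivity.HubbardSuperconductivity.Theorems.KLProgrammeSalmhoferCutoffFourthDerivBound

/-!
# K3 VL child `KLRegimeVolumeLimitV17F2` (stmt-HubbardSuperconductivity-20440), located item «SCALE-0-STEPCOV», part 3a (INCREMENT SYMBOL DATA): pointwise data of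
# the plain slice-symbol INCREMENT `(βV²)⁻²·(Ψ̂_{(Λ₂,Λ₁]}[K′] − Ψ̂_{(Λ₂,Λ₁]}[K])` between two frames whose band increment has the two-scale jets of ONE flow piece
# (`|·| ≤ G₀/x²`, `‖D·‖ ≤ G₀/x`, `‖D²·‖ ≤ G₀`, `‖D³·‖ ≤ G₀x`) and whose base band has `‖D³e_K‖ ≤ K₃ˢ·x` — every datum carries the factor `G₀`

Cell `gate-hubbard-kl`, seat p3 (g17).  The frame telescope of the first step covariance (part 1 `klStepCov_zero_sub_eq`: `klStepCov[K′] 0 − klStepCov[K] 0` is the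
constant-multiplier pull-back of the normal covariance with symbol `ΨΔ = Ψ̂[K′] − Ψ̂[K]`) needs, piece by piece, the weighted `ℓ¹` norms of the character sum of
`(βV²)⁻²ΨΔ`; the master lemmas read its pointwise differences.  This file supplies them from k3c3-p2's torus increment lemmas
(`norm_sliceSymbolTorusIncr_le`, `norm_fwdDiff_two/three_space_sliceSymbolTorusIncr_le`, `norm_fwdDiff_three_time_sliceSymbolTorusIncr_le`) at a base
frame `K` with `FrameOK R U N μ K` (`‖De_K‖, ‖D²e_K‖ ≤ 7`) in the two-scale class `(G₀, x)` of a flow piece (`0 ≤ G₀ ≤ 1 ≤ x`):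

* §0 the jet polynomials in the two-scale class (`jets_cube_le`, `jets_mixed_le`, …): every Leibniz term of order `k` is `≤ G₀·x·(const)·ℓᵏ`;
* §1 **`incrSymbol_sup_le`** (`≤ (βV²)⁻²·D₁βV²/Λ₂²·(G₀/x²)`), **`incrSymbol_three_space_le`** (`≤ (βV²)⁻²·βV²·(2π/V)³·(G₀x)·Y₃(K₃ˢ)`),
  **`incrSymbol_two_space_le`** (`≤ (βV²)⁻²·βV²·(2π/V)²·G₀·Y₂`), **`incrSymbol_three_time_le`** (`≤ (βV²)⁻²·(2π/β)³·D₄βV²/Λ₂⁵·(G₀/x²)`, regime window),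
  with `Y₂ = 64D₃/Λ₂⁴ + 23D₂/Λ₂³ + D₁/Λ₂²`, `Y₃ = 512D₄′/Λ₂⁵ + 361D₃/Λ₂⁴ + (45 + K₃ˢ + 1)D₂/Λ₂³ + D₁/Λ₂²` in the cutoff numerals
  (`B₁ = 32/3`, `B₂ = 448e²/3`, `B₃ = 44900`, `B₄ = 3960000`).
Parts 3b/3c assemble the all-times (`∝ (M/β)·G₀/x`) and sectional (`∝ G₀/x`) weighted `ℓ¹` bounds at the rate `s⁎/x`.

Everything is proved; no definitions, no sorry.  Nothing asserts any stub, K3, VL or superconductivity.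
[cite: BenfattoGiulianiMastropietro2006, Lemma 2.2 (2.52)–(2.55), §3 (3.2)–(3.8)]
-/

noncomputable section

namespace Summit.HubbardSuperconductivity.HubbardSuperconductivity.Theorems.TorusFourierL2

set_option linter.dupNamespace false -- summit = problem name (single-conjunct summit), D-0017

open Set Finset Literature.MathematicalPhysics.QuantumLattice Literature.MathematicalPhysics.QuantumLattice.BandSectorCounting
open Literature.MathematicalPhysics.QuantumLattice.FermiRG Literature.Probability.LatticeModels Literature.Analysis.SpecialFunctions
open Summit.HubbardSuperconductivity.HubbardSuperconductivity.Theorems.DispersionFlow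
open Summit.HubbardSuperconductivity.HubbardSuperconductivity.Theorems.KLRegimeSplit
open Summit.HubbardSuperconductivity.HubbardSuperconductivity.Theorems.KLProgrammeLegKernels
open Summit.HubbardSuperconductivity.HubbardSuperconductivity.Theorems.PerturbedFermiCurve
open Summit.HubbardSuperconductivity.HubbardSuperconductivity.Theorems.KLRegimeWick
open Summit.HubbardSuperconductivity.HubbardSuperconductivity.Theorems.TwoVolumeSource
open scoped Real Nat

open Classical

/-! ## §0 The jet polynomials in the two-scale class `(G₀, x)` -/

section Jets

variable {ℓ G₀ x : ℝ}

/-- `G₀/x² ≤ G₀` and `G₀/x ≤ G₀` for `0 ≤ G₀`, `1 ≤ x`. [folklore] -/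
theorem jets_low_le (hG : 0 ≤ G₀) (hx : 1 ≤ x) : G₀ / x ^ 2 ≤ G₀ ∧ G₀ / x ≤ G₀ := by
  have hx0 : 0 < x := by linarith
  refine ⟨div_le_self hG (one_le_pow₀ hx), div_le_self hG hx⟩

/-- The order-three leading Leibniz term: `(G₀/x²)·(7ℓ + (G₀/x)ℓ)³ ≤ G₀x·(512ℓ³)`. [folklore] -/
theorem jets_cube_le (hℓ : 0 ≤ ℓ) (hG : 0 ≤ G₀) (hG1 : G₀ ≤ 1) (hx : 1 ≤ x) :
    G₀ / x ^ 2 * (7 * ℓ + G₀ / x * ℓ) ^ 3 ≤ G₀ * x * (512 * ℓ ^ 3) := by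
  obtain ⟨h0, h1⟩ := jets_low_le hG hx
  have hP1 : G₀ / x ≤ 1 := h1.trans hG1
  have hb : 7 * ℓ + G₀ / x * ℓ ≤ 8 * ℓ := by nlinarith
  have hP10 : 0 ≤ G₀ / x := by positivity
  have hb0 : 0 ≤ 7 * ℓ + G₀ / x * ℓ := by positivity
  have hc : (7 * ℓ + G₀ / x * ℓ) ^ 3 ≤ 512 * ℓ ^ 3 := by
    calc (7 * ℓ + G₀ / x * ℓ) ^ 3 ≤ (8 * ℓ) ^ 3 := pow_le_pow_left₀ hb0 hb 3
      _ = 512 * ℓ ^ 3 := by ring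
  have hGx : G₀ / x ^ 2 ≤ G₀ * x := h0.trans (le_mul_of_one_le_right hG hx)
  exact mul_le_mul hGx hc (by positivity) (by positivity)

/-- The order-three middle Leibniz term: `(G₀/x)ℓ·(3(7ℓ)² + 3(7ℓ)((G₀/x)ℓ) + ((G₀/x)ℓ)²) ≤ G₀x·(169ℓ³)`. [folklore] -/
theorem jets_mid_le (hℓ : 0 ≤ ℓ) (hG : 0 ≤ G₀) (hG1 : G₀ ≤ 1) (hx : 1 ≤ x) :
    G₀ / x * ℓ * (3 * (7 * ℓ) ^ 2 + 3 * (7 * ℓ) * (G₀ / x * ℓ) + (G₀ / x * ℓ) ^ 2) ≤ G₀ * x * (169 * ℓ ^ 3) := by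
  obtain ⟨-, h1⟩ := jets_low_le hG hx
  have hP1 : G₀ / x ≤ 1 := h1.trans hG1
  have hP10 : 0 ≤ G₀ / x := by positivity
  have hq : 3 * (7 * ℓ) ^ 2 + 3 * (7 * ℓ) * (G₀ / x * ℓ) + (G₀ / x * ℓ) ^ 2 ≤ 169 * ℓ ^ 2 := by
    nlinarith [mul_nonneg hP10 (sq_nonneg ℓ), mul_le_mul_of_nonneg_right hP1 (sq_nonneg ℓ), mul_le_mul hP1 hP1 hP10 zero_le_one]
  have hGx : G₀ / x * ℓ ≤ G₀ * x * ℓ := mul_le_mul_of_nonneg_right (h1.trans (le_mul_of_one_le_right hG hx)) hℓ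
  calc G₀ / x * ℓ * (3 * (7 * ℓ) ^ 2 + 3 * (7 * ℓ) * (G₀ / x * ℓ) + (G₀ / x * ℓ) ^ 2) ≤ G₀ * x * ℓ * (169 * ℓ ^ 2) :=
        mul_le_mul hGx hq (by positivity) (by positivity)
    _ = G₀ * x * (169 * ℓ ^ 3) := by ring

/-- The order-three mixed Leibniz terms: `(G₀/x²)(7ℓ + (G₀/x)ℓ)(7ℓ² + G₀ℓ²) ≤ G₀x·(64ℓ³)` and `7ℓ(G₀ℓ²) + (G₀/x)ℓ(7ℓ²) + (G₀/x)ℓ(G₀ℓ²) ≤ G₀x·(15ℓ³)`.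
[folklore] -/
theorem jets_mixed_le (hℓ : 0 ≤ ℓ) (hG : 0 ≤ G₀) (hG1 : G₀ ≤ 1) (hx : 1 ≤ x) :
    G₀ / x ^ 2 * (7 * ℓ + G₀ / x * ℓ) * (7 * ℓ ^ 2 + G₀ * ℓ ^ 2) ≤ G₀ * x * (64 * ℓ ^ 3) ∧
    7 * ℓ * (G₀ * ℓ ^ 2) + G₀ / x * ℓ * (7 * ℓ ^ 2) + G₀ / x * ℓ * (G₀ * ℓ ^ 2) ≤ G₀ * x * (15 * ℓ ^ 3) := by
  obtain ⟨h0, h1⟩ := jets_low_le hG hx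
  have hP1 : G₀ / x ≤ 1 := h1.trans hG1
  have hP10 : 0 ≤ G₀ / x := by positivity
  have hGx : G₀ ≤ G₀ * x := le_mul_of_one_le_right hG hx
  refine ⟨?_, ?_⟩
  · have ha : 7 * ℓ + G₀ / x * ℓ ≤ 8 * ℓ := by nlinarith
    have hb : 7 * ℓ ^ 2 + G₀ * ℓ ^ 2 ≤ 8 * ℓ ^ 2 := by nlinarith [sq_nonneg ℓ]
    have ha0 : 0 ≤ 7 * ℓ + G₀ / x * ℓ := by positivity
    calc G₀ / x ^ 2 * (7 * ℓ + G₀ / x * ℓ) * (7 * ℓ ^ 2 + G₀ * ℓ ^ 2) ≤ G₀ * x * (8 * ℓ) * (8 * ℓ ^ 2) := by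
          refine mul_le_mul (mul_le_mul (h0.trans hGx) ha ha0 (by positivity)) hb (by positivity) (by positivity)
      _ = G₀ * x * (64 * ℓ ^ 3) := by ring
  · have e : 7 * ℓ * (G₀ * ℓ ^ 2) + G₀ / x * ℓ * (7 * ℓ ^ 2) + G₀ / x * ℓ * (G₀ * ℓ ^ 2) = ℓ ^ 3 * (7 * G₀ + 7 * (G₀ / x) + G₀ / x * G₀) := by ring
    rw [e]
    have : 7 * G₀ + 7 * (G₀ / x) + G₀ / x * G₀ ≤ 15 * (G₀ * x) := by nlinarith [mul_le_mul hP1 hGx hG zero_le_one]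
    nlinarith [pow_nonneg hℓ 3]

/-- The order-three terms carrying the third jets: `(G₀/x²)(K₃ˢxℓ³ + G₀xℓ³) ≤ G₀x·((K₃ˢ+1)ℓ³)` and `G₀xℓ³ ≤ G₀x·ℓ³`. [folklore] -/
theorem jets_third_le (hℓ : 0 ≤ ℓ) (hG : 0 ≤ G₀) (hG1 : G₀ ≤ 1) (hx : 1 ≤ x) {K₃s : ℝ} (hK : 0 ≤ K₃s) :
    G₀ / x ^ 2 * (K₃s * x * ℓ ^ 3 + G₀ * x * ℓ ^ 3) ≤ G₀ * x * ((K₃s + 1) * ℓ ^ 3) := by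
  have hx0 : 0 < x := by linarith
  have e : G₀ / x ^ 2 * (K₃s * x * ℓ ^ 3 + G₀ * x * ℓ ^ 3) = G₀ / x * ((K₃s + G₀) * ℓ ^ 3) := by field_simp
  rw [e]
  have h1 : G₀ / x ≤ G₀ * x := (div_le_self hG hx).trans (le_mul_of_one_le_right hG hx)
  exact mul_le_mul h1 (mul_le_mul_of_nonneg_right (by linarith) (by positivity)) (by positivity) (by positivity)

/-- The order-two Leibniz terms: `(G₀/x²)(7ℓ + (G₀/x)ℓ)² ≤ G₀·(64ℓ²)`, `(G₀/x)ℓ(2(7ℓ) + (G₀/x)ℓ) ≤ G₀·(15ℓ²)`, `(G₀/x²)(7ℓ² + G₀ℓ²) ≤ G₀·(8ℓ²)`.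
[folklore] -/
theorem jets_two_le (hℓ : 0 ≤ ℓ) (hG : 0 ≤ G₀) (hG1 : G₀ ≤ 1) (hx : 1 ≤ x) :
    G₀ / x ^ 2 * (7 * ℓ + G₀ / x * ℓ) ^ 2 ≤ G₀ * (64 * ℓ ^ 2) ∧
    G₀ / x * ℓ * (2 * (7 * ℓ) + G₀ / x * ℓ) ≤ G₀ * (15 * ℓ ^ 2) ∧
    G₀ / x ^ 2 * (7 * ℓ ^ 2 + G₀ * ℓ ^ 2) ≤ G₀ * (8 * ℓ ^ 2) := by
  obtain ⟨h0, h1⟩ := jets_low_le hG hx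
  have hP1 : G₀ / x ≤ 1 := h1.trans hG1
  have hP10 : 0 ≤ G₀ / x := by positivity
  refine ⟨?_, ?_, ?_⟩
  · have ha : 7 * ℓ + G₀ / x * ℓ ≤ 8 * ℓ := by nlinarith
    have ha0 : 0 ≤ 7 * ℓ + G₀ / x * ℓ := by positivity
    calc G₀ / x ^ 2 * (7 * ℓ + G₀ / x * ℓ) ^ 2 ≤ G₀ * (8 * ℓ) ^ 2 := mul_le_mul h0 (pow_le_pow_left₀ ha0 ha 2) (by positivity) hG
      _ = G₀ * (64 * ℓ ^ 2) := by ring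
  · have ha : 2 * (7 * ℓ) + G₀ / x * ℓ ≤ 15 * ℓ := by nlinarith
    calc G₀ / x * ℓ * (2 * (7 * ℓ) + G₀ / x * ℓ) ≤ G₀ * ℓ * (15 * ℓ) :=
          mul_le_mul (mul_le_mul_of_nonneg_right h1 hℓ) ha (by positivity) (by positivity)
      _ = G₀ * (15 * ℓ ^ 2) := by ring
  · have hb : 7 * ℓ ^ 2 + G₀ * ℓ ^ 2 ≤ 8 * ℓ ^ 2 := by nlinarith [sq_nonneg ℓ]
    exact mul_le_mul h0 hb (by positivity) hG

end Jets

/-! ## §1 Pointwise data of the symbol increment in the two-scale class -/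

section Pointwise

variable {V M : ℕ} [NeZero V] [NeZero M] {R : RenConsts} {U : ℝ} {N : ℕ} {μ : ℝ} {K K' : TrigPolyC4v} {β G₀ x : ℝ}

omit [NeZero V] in
/-- **Sup of the increment**: `‖(βV²)⁻²ΨΔ(q)‖ ≤ (βV²)⁻²·D₁βV²/Λ₂²·(G₀/x²)` (`|e_{K′} − e_K| ≤ G₀/x²`). [cite: BenfattoGiulianiMastropietro2006, §3 (3.2)] -/
theorem incrSymbol_sup_le (hβ : 0 < β) (hv₀ : ∀ p, |frameLevel μ K' p - frameLevel μ K p| ≤ G₀ / x ^ 2) (q : TorusSite 1 (2 * M) × TorusSite 2 V) :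
    ‖(((1 / (β * (V : ℝ) ^ 2) : ℝ) : ℂ)) ^ 2 *
        (sliceSymbolFnXi (β * (V : ℝ) ^ 2) 0 (klScale klE0 2) (klScale klE0 1) (matsubaraFreq β M ⟨(q.1 0).val, ZMod.val_lt (q.1 0)⟩) (nambuXiCT V μ K' q.2) -
          sliceSymbolFnXi (β * (V : ℝ) ^ 2) 0 (klScale klE0 2) (klScale klE0 1) (matsubaraFreq β M ⟨(q.1 0).val, ZMod.val_lt (q.1 0)⟩) (nambuXiCT V μ K q.2))‖ ≤
      (1 / (β * (V : ℝ) ^ 2)) ^ 2 * ((16 * (32 / 3) + 16) * (β * (V : ℝ) ^ 2) / klScale klE0 2 ^ 2 * (G₀ / x ^ 2)) := by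
  have he : (0 : ℝ) < klE0 := by norm_num [klE0]
  have hB₁ : ∀ x, |deriv salmhoferCutoff x| ≤ 32 / 3 := klcd_abs_deriv_salmhoferCutoff_le_sharp
  rw [norm_mul, norm_invVol_sq hβ]
  exact mul_le_mul_of_nonneg_left (norm_sliceSymbolTorusIncr_le (β := β) (μ := μ) (K := K) (K' := K') (klth_klScale_pos 2)
    (EngineV8.klScale_le_klScale he.le (by norm_num)) (by positivity) hB₁ hv₀ q) (by positivity)

/-- **Third spatial difference of the increment along a unit integer direction** in the two-scale class `(G₀, x)` at a `FrameOK` base frame with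
`‖D³e_K‖ ≤ K₃ˢx`: `≤ (βV²)⁻²·(βV²·(2π/V)³·(G₀x)·Y₃(K₃ˢ))`. [cite: BenfattoGiulianiMastropietro2006, Lemma 2.2 (2.52)–(2.55), §3 (3.2)] -/
theorem incrSymbol_three_space_le (hK : FrameOK R U N μ K) (hβ : 0 < β) (hG : 0 ≤ G₀) (hG1 : G₀ ≤ 1) (hx : 1 ≤ x) {K₃s : ℝ} (hK₃s : 0 ≤ K₃s)
    (hK3 : ∀ p, ‖iteratedFDeriv ℝ 3 (frameLevel μ K) p‖ ≤ K₃s * x)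
    (hv₀ : ∀ p, |frameLevel μ K' p - frameLevel μ K p| ≤ G₀ / x ^ 2)
    (hv₁ : ∀ p, ‖fderiv ℝ (fun p => frameLevel μ K' p - frameLevel μ K p) p‖ ≤ G₀ / x)
    (hv₂ : ∀ p, ‖iteratedFDeriv ℝ 2 (fun p => frameLevel μ K' p - frameLevel μ K p) p‖ ≤ G₀)
    (hv₃ : ∀ p, ‖iteratedFDeriv ℝ 3 (fun p => frameLevel μ K' p - frameLevel μ K p) p‖ ≤ G₀ * x)
    (r : Fin 2 → ℤ) (hr : (r 0 : ℝ) ^ 2 + (r 1 : ℝ) ^ 2 = 1) (q : TorusSite 1 (2 * M) × TorusSite 2 V) :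
    ‖((fwdDiff ((0 : TorusSite 1 (2 * M)), (fun i => ((r i : ℤ) : ZMod V))))^[3]
        (fun y : TorusSite 1 (2 * M) × TorusSite 2 V => (((1 / (β * (V : ℝ) ^ 2) : ℝ) : ℂ)) ^ 2 *
          (sliceSymbolFnXi (β * (V : ℝ) ^ 2) 0 (klScale klE0 2) (klScale klE0 1) (matsubaraFreq β M ⟨(y.1 0).val, ZMod.val_lt (y.1 0)⟩) (nambuXiCT V μ K' y.2) -
            sliceSymbolFnXi (β * (V : ℝ) ^ 2) 0 (klScale klE0 2) (klScale klE0 1) (matsubaraFreq β M ⟨(y.1 0).val, ZMod.val_lt (y.1 0)⟩) (nambuXiCT V μ K y.2)))) q‖ ≤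
      (1 / (β * (V : ℝ) ^ 2)) ^ 2 * ((β * (V : ℝ) ^ 2) * (2 * π / V) ^ 3 * (G₀ * x) *
        (512 * (128 * 3960000 + 1408 * 44900 + 7776 * (448 / 3 * Real.exp 2) + 27648 * (32 / 3) + 24576) / klScale klE0 2 ^ 5 +
          361 * (64 * 44900 + 480 * (448 / 3 * Real.exp 2) + 1728 * (32 / 3) + 1536) / klScale klE0 2 ^ 4 +
          (45 + (K₃s + 1)) * (32 * (448 / 3 * Real.exp 2) + 144 * (32 / 3) + 128) / klScale klE0 2 ^ 3 + (16 * (32 / 3) + 16) / klScale klE0 2 ^ 2)) := by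
  have he : (0 : ℝ) < klE0 := by norm_num [klE0]
  have hΛ2 : 0 < klScale klE0 2 := klth_klScale_pos 2
  have hΛ21 : klScale klE0 2 ≤ klScale klE0 1 := EngineV8.klScale_le_klScale he.le (by norm_num)
  have hV1 : (1 : ℝ) ≤ V := by exact_mod_cast Nat.pos_of_ne_zero (NeZero.ne V)
  have hV0 : (0 : ℝ) < V := by linarith
  have hc : 0 < β * (V : ℝ) ^ 2 := by positivity
  have hB₁ : ∀ x, |deriv salmhoferCutoff x| ≤ 32 / 3 := klcd_abs_deriv_salmhoferCutoff_le_sharp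
  have hB₂ : ∀ x, |deriv (deriv salmhoferCutoff) x| ≤ 448 / 3 * Real.exp 2 := klsd_abs_deriv2_salmhoferCutoff_le
  have hB₃ : ∀ x, |deriv (deriv (deriv salmhoferCutoff)) x| ≤ 44900 := fun x => (kltd_abs_deriv3_salmhoferCutoff_lt x).le
  have hB₄ : ∀ x, |deriv (deriv (deriv (deriv salmhoferCutoff))) x| ≤ 3960000 := fun x => (kltd_abs_deriv4_salmhoferCutoff_lt x).le
  have hK₁ : ∀ p, ‖fderiv ℝ (frameLevel μ K) p‖ ≤ 7 := fun p => norm_fderiv_frameLevel_le_of_frameOK hK p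
  have hK₂ : ∀ p, ‖iteratedFDeriv ℝ 2 (frameLevel μ K) p‖ ≤ 7 := fun p => norm_iteratedFDeriv_two_frameLevel_le_of_frameOK hK p
  have hstep := norm_toLp_unitStep V hr
  rw [fwdDiff_iter_const_mul, norm_mul, norm_invVol_sq hβ]
  refine mul_le_mul_of_nonneg_left ?_ (by positivity)
  have h3 := norm_fwdDiff_three_space_sliceSymbolTorusIncr_le (c := β * (V : ℝ) ^ 2) (β := β) (M := M) hK₁ hK₂ hK3 hv₀ hv₁ hv₂ hv₃ hΛ2 hΛ21 hc.le
    hB₁ hB₂ hB₃ hB₄ r q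
  rw [hstep] at h3
  refine h3.trans ?_
  set ℓ : ℝ := 2 * π / V with hℓdef
  set Λ₂ : ℝ := klScale klE0 2 with hΛ₂def
  set c : ℝ := β * (V : ℝ) ^ 2 with hcdef
  set D₁ : ℝ := 16 * (32 / 3 : ℝ) + 16 with hD₁
  set D₂ : ℝ := 32 * (448 / 3 * Real.exp 2) + 144 * (32 / 3 : ℝ) + 128 with hD₂
  set D₃ : ℝ := 64 * (44900 : ℝ) + 480 * (448 / 3 * Real.exp 2) + 1728 * (32 / 3 : ℝ) + 1536 with hD₃
  set D₄ : ℝ := 128 * (3960000 : ℝ) + 1408 * 44900 + 7776 * (448 / 3 * Real.exp 2) + 27648 * (32 / 3 : ℝ) + 24576 with hD₄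
  have hD₁0 : 0 < D₁ := by rw [hD₁]; norm_num
  have hD₂0 : 0 < D₂ := by rw [hD₂]; positivity
  have hD₃0 : 0 < D₃ := by rw [hD₃]; positivity
  have hD₄0 : 0 < D₄ := by rw [hD₄]; positivity
  have hℓ0 : 0 ≤ ℓ := by positivity
  have t1 := jets_cube_le hℓ0 hG hG1 hx
  have t2 := jets_mid_le hℓ0 hG hG1 hx
  obtain ⟨t3a, t3b⟩ := jets_mixed_le hℓ0 hG hG1 hx
  have t4 := jets_third_le hℓ0 hG hG1 hx hK₃s
  have hx0 : 0 ≤ x := by linarith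
  have hGx0 : 0 ≤ G₀ * x := by positivity
  -- rewrite the Leibniz expression into the jet polynomials
  have e : D₄ * c / Λ₂ ^ 5 * (G₀ / x ^ 2) * (7 * ℓ + G₀ / x * ℓ) ^ 3 +
        D₃ * c / Λ₂ ^ 4 * (G₀ / x * ℓ * (3 * (7 * ℓ) ^ 2 + 3 * (7 * ℓ) * (G₀ / x * ℓ) + (G₀ / x * ℓ) ^ 2)) +
        3 * (D₃ * c / Λ₂ ^ 4 * (G₀ / x ^ 2) * ((7 * ℓ + G₀ / x * ℓ) * (7 * ℓ ^ 2 + G₀ * ℓ ^ 2)) +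
          D₂ * c / Λ₂ ^ 3 * (7 * ℓ * (G₀ * ℓ ^ 2) + G₀ / x * ℓ * (7 * ℓ ^ 2) + G₀ / x * ℓ * (G₀ * ℓ ^ 2))) +
        (D₂ * c / Λ₂ ^ 3 * (G₀ / x ^ 2) * (K₃s * x * ℓ ^ 3 + G₀ * x * ℓ ^ 3) + D₁ * c / Λ₂ ^ 2 * (G₀ * x * ℓ ^ 3)) =
      D₄ * c / Λ₂ ^ 5 * (G₀ / x ^ 2 * (7 * ℓ + G₀ / x * ℓ) ^ 3) +
        D₃ * c / Λ₂ ^ 4 * (G₀ / x * ℓ * (3 * (7 * ℓ) ^ 2 + 3 * (7 * ℓ) * (G₀ / x * ℓ) + (G₀ / x * ℓ) ^ 2)) +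
        3 * (D₃ * c / Λ₂ ^ 4 * (G₀ / x ^ 2 * (7 * ℓ + G₀ / x * ℓ) * (7 * ℓ ^ 2 + G₀ * ℓ ^ 2)) +
          D₂ * c / Λ₂ ^ 3 * (7 * ℓ * (G₀ * ℓ ^ 2) + G₀ / x * ℓ * (7 * ℓ ^ 2) + G₀ / x * ℓ * (G₀ * ℓ ^ 2))) +
        (D₂ * c / Λ₂ ^ 3 * (G₀ / x ^ 2 * (K₃s * x * ℓ ^ 3 + G₀ * x * ℓ ^ 3)) + D₁ * c / Λ₂ ^ 2 * (G₀ * x * ℓ ^ 3)) := by ring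
  rw [e]
  have f : c * ℓ ^ 3 * (G₀ * x) * (512 * D₄ / Λ₂ ^ 5 + 361 * D₃ / Λ₂ ^ 4 + (45 + (K₃s + 1)) * D₂ / Λ₂ ^ 3 + D₁ / Λ₂ ^ 2) =
      D₄ * c / Λ₂ ^ 5 * (G₀ * x * (512 * ℓ ^ 3)) + D₃ * c / Λ₂ ^ 4 * (G₀ * x * (169 * ℓ ^ 3)) +
        3 * (D₃ * c / Λ₂ ^ 4 * (G₀ * x * (64 * ℓ ^ 3)) + D₂ * c / Λ₂ ^ 3 * (G₀ * x * (15 * ℓ ^ 3))) +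
        (D₂ * c / Λ₂ ^ 3 * (G₀ * x * ((K₃s + 1) * ℓ ^ 3)) + D₁ * c / Λ₂ ^ 2 * (G₀ * x * ℓ ^ 3)) := by ring
  rw [f]
  gcongr

/-- **Second spatial difference of the increment along a unit integer direction** in the two-scale class at a `FrameOK` base frame:
`≤ (βV²)⁻²·(βV²·(2π/V)²·G₀·Y₂)`, `Y₂ = 64D₃/Λ₂⁴ + 23D₂/Λ₂³ + D₁/Λ₂²`. [cite: BenfattoGiulianiMastropietro2006, Lemma 2.2 (2.36aa), §3 (3.2)] -/
theorem incrSymbol_two_space_le (hK : FrameOK R U N μ K) (hβ : 0 < β) (hG : 0 ≤ G₀) (hG1 : G₀ ≤ 1) (hx : 1 ≤ x)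
    (hv₀ : ∀ p, |frameLevel μ K' p - frameLevel μ K p| ≤ G₀ / x ^ 2)
    (hv₁ : ∀ p, ‖fderiv ℝ (fun p => frameLevel μ K' p - frameLevel μ K p) p‖ ≤ G₀ / x)
    (hv₂ : ∀ p, ‖iteratedFDeriv ℝ 2 (fun p => frameLevel μ K' p - frameLevel μ K p) p‖ ≤ G₀)
    (r : Fin 2 → ℤ) (hr : (r 0 : ℝ) ^ 2 + (r 1 : ℝ) ^ 2 = 1) (q : TorusSite 1 (2 * M) × TorusSite 2 V) :
    ‖((fwdDiff ((0 : TorusSite 1 (2 * M)), (fun i => ((r i : ℤ) : ZMod V))))^[2]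
        (fun y : TorusSite 1 (2 * M) × TorusSite 2 V => (((1 / (β * (V : ℝ) ^ 2) : ℝ) : ℂ)) ^ 2 *
          (sliceSymbolFnXi (β * (V : ℝ) ^ 2) 0 (klScale klE0 2) (klScale klE0 1) (matsubaraFreq β M ⟨(y.1 0).val, ZMod.val_lt (y.1 0)⟩) (nambuXiCT V μ K' y.2) -
            sliceSymbolFnXi (β * (V : ℝ) ^ 2) 0 (klScale klE0 2) (klScale klE0 1) (matsubaraFreq β M ⟨(y.1 0).val, ZMod.val_lt (y.1 0)⟩) (nambuXiCT V μ K y.2)))) q‖ ≤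
      (1 / (β * (V : ℝ) ^ 2)) ^ 2 * ((β * (V : ℝ) ^ 2) * (2 * π / V) ^ 2 * G₀ *
        (64 * (64 * 44900 + 480 * (448 / 3 * Real.exp 2) + 1728 * (32 / 3) + 1536) / klScale klE0 2 ^ 4 +
          23 * (32 * (448 / 3 * Real.exp 2) + 144 * (32 / 3) + 128) / klScale klE0 2 ^ 3 + (16 * (32 / 3) + 16) / klScale klE0 2 ^ 2)) := by
  have he : (0 : ℝ) < klE0 := by norm_num [klE0]
  have hΛ2 : 0 < klScale klE0 2 := klth_klScale_pos 2
  have hΛ21 : klScale klE0 2 ≤ klScale klE0 1 := EngineV8.klScale_le_klScale he.le (by norm_num)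
  have hV1 : (1 : ℝ) ≤ V := by exact_mod_cast Nat.pos_of_ne_zero (NeZero.ne V)
  have hV0 : (0 : ℝ) < V := by linarith
  have hc : 0 < β * (V : ℝ) ^ 2 := by positivity
  have hB₁ : ∀ x, |deriv salmhoferCutoff x| ≤ 32 / 3 := klcd_abs_deriv_salmhoferCutoff_le_sharp
  have hB₂ : ∀ x, |deriv (deriv salmhoferCutoff) x| ≤ 448 / 3 * Real.exp 2 := klsd_abs_deriv2_salmhoferCutoff_le
  have hB₃ : ∀ x, |deriv (deriv (deriv salmhoferCutoff)) x| ≤ 44900 := fun x => (kltd_abs_deriv3_salmhoferCutoff_lt x).le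
  have hK₁ : ∀ p, ‖fderiv ℝ (frameLevel μ K) p‖ ≤ 7 := fun p => norm_fderiv_frameLevel_le_of_frameOK hK p
  have hK₂ : ∀ p, ‖iteratedFDeriv ℝ 2 (frameLevel μ K) p‖ ≤ 7 := fun p => norm_iteratedFDeriv_two_frameLevel_le_of_frameOK hK p
  have hstep := norm_toLp_unitStep V hr
  rw [fwdDiff_iter_const_mul, norm_mul, norm_invVol_sq hβ]
  refine mul_le_mul_of_nonneg_left ?_ (by positivity)
  have h2 := norm_fwdDiff_two_space_sliceSymbolTorusIncr_le (c := β * (V : ℝ) ^ 2) (β := β) (M := M) hK₁ hK₂ hv₀ hv₁ hv₂ hΛ2 hΛ21 hc.le hB₁ hB₂ hB₃ r q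
  rw [hstep] at h2
  refine h2.trans ?_
  set ℓ : ℝ := 2 * π / V with hℓdef
  set Λ₂ : ℝ := klScale klE0 2 with hΛ₂def
  set c : ℝ := β * (V : ℝ) ^ 2 with hcdef
  set D₁ : ℝ := 16 * (32 / 3 : ℝ) + 16 with hD₁
  set D₂ : ℝ := 32 * (448 / 3 * Real.exp 2) + 144 * (32 / 3 : ℝ) + 128 with hD₂
  set D₃ : ℝ := 64 * (44900 : ℝ) + 480 * (448 / 3 * Real.exp 2) + 1728 * (32 / 3 : ℝ) + 1536 with hD₃
  have hD₁0 : 0 < D₁ := by rw [hD₁]; norm_num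
  have hD₂0 : 0 < D₂ := by rw [hD₂]; positivity
  have hD₃0 : 0 < D₃ := by rw [hD₃]; positivity
  have hℓ0 : 0 ≤ ℓ := by positivity
  obtain ⟨u1, u2, u3⟩ := jets_two_le hℓ0 hG hG1 hx
  have e : D₃ * c / Λ₂ ^ 4 * (G₀ / x ^ 2) * (7 * ℓ + G₀ / x * ℓ) ^ 2 + D₂ * c / Λ₂ ^ 3 * (G₀ / x * ℓ * (2 * (7 * ℓ) + G₀ / x * ℓ)) +
        (D₂ * c / Λ₂ ^ 3 * (G₀ / x ^ 2) * (7 * ℓ ^ 2 + G₀ * ℓ ^ 2) + D₁ * c / Λ₂ ^ 2 * (G₀ * ℓ ^ 2)) =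
      D₃ * c / Λ₂ ^ 4 * (G₀ / x ^ 2 * (7 * ℓ + G₀ / x * ℓ) ^ 2) + D₂ * c / Λ₂ ^ 3 * (G₀ / x * ℓ * (2 * (7 * ℓ) + G₀ / x * ℓ)) +
        (D₂ * c / Λ₂ ^ 3 * (G₀ / x ^ 2 * (7 * ℓ ^ 2 + G₀ * ℓ ^ 2)) + D₁ * c / Λ₂ ^ 2 * (G₀ * ℓ ^ 2)) := by ring
  rw [e]
  have f : c * ℓ ^ 2 * G₀ * (64 * D₃ / Λ₂ ^ 4 + 23 * D₂ / Λ₂ ^ 3 + D₁ / Λ₂ ^ 2) =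
      D₃ * c / Λ₂ ^ 4 * (G₀ * (64 * ℓ ^ 2)) + D₂ * c / Λ₂ ^ 3 * (G₀ * (15 * ℓ ^ 2)) +
        (D₂ * c / Λ₂ ^ 3 * (G₀ * (8 * ℓ ^ 2)) + D₁ * c / Λ₂ ^ 2 * (G₀ * ℓ ^ 2)) := by ring
  rw [f]
  gcongr

omit [NeZero V] in
/-- **Third time difference of the increment** in the regime window (`klBetaMin ≤ β ≤ M`): `≤ (βV²)⁻²·(2π/β)³·D₄″βV²/Λ₂⁵·(G₀/x²)`.
[cite: BenfattoGiulianiMastropietro2006, §3 (3.2)–(3.8)] -/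
theorem incrSymbol_three_time_le (hβmin : klBetaMin ≤ β) (hβM : β ≤ (M : ℝ)) (hv₀ : ∀ p, |frameLevel μ K' p - frameLevel μ K p| ≤ G₀ / x ^ 2)
    (q : TorusSite 1 (2 * M) × TorusSite 2 V) :
    ‖((fwdDiff ((fun _ : Fin 1 => (1 : ZMod (2 * M))), (0 : TorusSite 2 V)))^[3]
        (fun y : TorusSite 1 (2 * M) × TorusSite 2 V => (((1 / (β * (V : ℝ) ^ 2) : ℝ) : ℂ)) ^ 2 *
          (sliceSymbolFnXi (β * (V : ℝ) ^ 2) 0 (klScale klE0 2) (klScale klE0 1) (matsubaraFreq β M ⟨(y.1 0).val, ZMod.val_lt (y.1 0)⟩) (nambuXiCT V μ K' y.2) -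
            sliceSymbolFnXi (β * (V : ℝ) ^ 2) 0 (klScale klE0 2) (klScale klE0 1) (matsubaraFreq β M ⟨(y.1 0).val, ZMod.val_lt (y.1 0)⟩) (nambuXiCT V μ K y.2)))) q‖ ≤
      (1 / (β * (V : ℝ) ^ 2)) ^ 2 * ((2 * π / β) ^ 3 *
        ((128 * 3960000 + 1216 * 44900 + 6912 * (448 / 3 * Real.exp 2) + 26112 * (32 / 3) + 24576) * (β * (V : ℝ) ^ 2) / klScale klE0 2 ^ 5 * (G₀ / x ^ 2))) := by
  have he : (0 : ℝ) < klE0 := by norm_num [klE0]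
  have hΛ2 : 0 < klScale klE0 2 := klth_klScale_pos 2
  have hΛ21 : klScale klE0 2 ≤ klScale klE0 1 := EngineV8.klScale_le_klScale he.le (by norm_num)
  have hβ0 : 0 < β := pos_of_klBetaMin_le hβmin
  have hc : 0 ≤ β * (V : ℝ) ^ 2 := by positivity
  have hB₁ : ∀ x, |deriv salmhoferCutoff x| ≤ 32 / 3 := klcd_abs_deriv_salmhoferCutoff_le_sharp
  have hB₂ : ∀ x, |deriv (deriv salmhoferCutoff) x| ≤ 448 / 3 * Real.exp 2 := klsd_abs_deriv2_salmhoferCutoff_le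
  have hB₃ : ∀ x, |deriv (deriv (deriv salmhoferCutoff)) x| ≤ 44900 := fun x => (kltd_abs_deriv3_salmhoferCutoff_lt x).le
  have hB₄ : ∀ x, |deriv (deriv (deriv (deriv salmhoferCutoff))) x| ≤ 3960000 := fun x => (kltd_abs_deriv4_salmhoferCutoff_lt x).le
  have hMw := klScale_one_lt_matsubara_window₅ hβmin hβM
  rw [fwdDiff_iter_const_mul, norm_mul, norm_invVol_sq hβ0]
  exact mul_le_mul_of_nonneg_left (norm_fwdDiff_three_time_sliceSymbolTorusIncr_le (c := β * (V : ℝ) ^ 2) (L := V) (μ := μ) (K := K) (K' := K')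
    hβ0 hΛ2 hΛ21 hMw hc hB₁ hB₂ hB₃ hB₄ hv₀ q) (by positivity)

end Pointwise

end Summit.HubbardSuperconductivity.HubbardSuperconductivity.Theorems.TorusFourierL2

end
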